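import Summits.QuantumFields.YangMills.Theorems.AllWindowsColdBoxBoxHighLineCubicCutInsideFPSharp
import Summits.QuantumFields.YangMills.Theorems.AllWindowsColdBoxBoxHighLineCubicCutBeta

/-!
# The cubic cut in the assembly's letters, SHARP form: FIXED moment order under (K4) `κ₃ + 4θ < 1/2` (planner ym-idea-2 g18 (N1), ASSEMBLY-U5 v0.1 §3 (D′))
# (LINE-20 U5 ⟨stmt-QuantumFields-24336⟩; U5 prep, helper-grade; U5 OPEN)

Width seat `ym-line-sfw-p2-w4` (prover-ym-line-sfw-p2-w4-g29-0).  ✓`SmallFieldFPSharp.cubicCutInsideFP_sharp` (w4 g29) has a CONSTANT bracket in the regime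
`s·H⁴ ≤ c₀`, which in the U5 letters `s = β^{−1/2+κ₃}`, `H ≤ β^θ + 1` holds for `β ≥ β₀` iff (K4) `κ₃ + 4θ < 1/2` (a constraint of record, ASSEMBLY-U5 §1); then the
FIXED moment order `k = ⌈(2q+1)/(1−4θ)⌉₊ + 1` makes `C·√p_k ≤ β^{−q}` (`p_k ≍ β^{−k(1−4θ)}·polylog`), with no `k(β)` optimisation (compare the (N2) fallback
✓`SmallFieldFP.exists_beta0_cubicCut`, constraint `19θ + 3κ₃ < 5/2`):

  ★★ **`SmallFieldFPSharp.exists_beta0_cubicCut_sharp`** — for `0 < θ`, `0 < κ₃`, `κ₃ + 4θ < 1/2`, `0 ≤ q`: there are `C₅ ≥ 0`, `β₀ ≥ 1` with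
  `∫_{smallField s ∩ E} w_J ≤ β^{−q}·∫_{smallField (s/2) ∖ E} w_J` for `β ≥ β₀`, `1 ≤ H ≤ β^θ + 1`, `r ≥ s = β^{−1/2+κ₃}`, `E = {1 + C₅βH⁴s⁵ ≤ |cubicVertex β H ·|}`.

Everything proved; no definitions; standard axioms.  HONEST LABEL: U5 prep, helper-grade; U5 ⟨24336⟩, ⟨24004⟩ and the seat's own crux ⟨22884⟩ remain OPEN; no stub is
closed by name, no crux, rung or summit is proved; **the Yang–Mills mass gap is NOT proved by this file; no summit is proved by a line.**
-/

set_option autoImplicit false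

open MeasureTheory Real Finset

namespace Summit.QuantumFields.YangMills.Theorems.AllWindowsColdBoxBoxHighLine

namespace SmallFieldFPSharp

open SmallFieldFP TiltSup

variable {H : ℕ}

/-- The tail monomial at `λ = 1`: `p_k = ((2k−1)^{3k}·8^k·C₅^k) · H^{4k} · (1+log H)^{3k} / β^k`. -/
theorem tail_monomial_eq (k : ℕ) (C₅ β Hr L : ℝ) :
    (2 * k - 1 : ℝ) ^ (k * 3) * (8 * (C₅ * Hr ^ 4 * L ^ 3) / β) ^ k / (1 : ℝ) ^ (2 * k) =
      ((2 * k - 1 : ℝ) ^ (k * 3) * 8 ^ k * C₅ ^ k) * Hr ^ (4 * k) * L ^ (3 * k) / β ^ k := by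
  rw [one_pow, div_one, div_pow, mul_pow, mul_pow, mul_pow, ← pow_mul, ← pow_mul]
  ring

/-- `β^k = β^{(k − 2q)}·β^{2q}` as real powers (`β > 0`). -/
theorem pow_eq_rpow_mul_rpow {β q : ℝ} (hβ : 0 < β) (k : ℕ) : β ^ k = β ^ ((k : ℝ) - 2 * q) * β ^ (2 * q) := by
  rw [← Real.rpow_add hβ, ← Real.rpow_natCast]; ring_nf

/-- ★★ **The cubic cut for `β ≥ β₀`, sharp form (fixed moment order under (K4)).** -/
theorem exists_beta0_cubicCut_sharp {θ κ₃ q : ℝ} (hθ : 0 < θ) (hκ0 : 0 < κ₃) (hK4 : κ₃ + 4 * θ < 1 / 2) (hq : 0 ≤ q) :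
    ∃ C₅ β₀ : ℝ, 0 ≤ C₅ ∧ 1 ≤ β₀ ∧ ∀ β : ℝ, β₀ ≤ β → ∀ H : ℕ, 1 ≤ H → (H : ℝ) ≤ β ^ θ + 1 → ∀ r : ℝ, β ^ (-1 / 2 + κ₃) ≤ r →
      ∫ a in smallField H (β ^ (-1 / 2 + κ₃)) ∩
          {a | 1 + C₅ * β * (H : ℝ) ^ 4 * (β ^ (-1 / 2 + κ₃)) ^ 5 ≤ |cubicVertex β H a|}, fpChartWeight β H r a ≤
        β ^ (-q) * ∫ a in smallField H (β ^ (-1 / 2 + κ₃) / 2) \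
          {a | 1 + C₅ * β * (H : ℝ) ^ 4 * (β ^ (-1 / 2 + κ₃)) ^ 5 ≤ |cubicVertex β H a|}, fpChartWeight β H r a := by
  obtain ⟨C, C₅, c₀, c₁, hc₀, hc₁, hC₅, hcut⟩ := cubicCutInsideFP_sharp
  have hθ0 : 0 ≤ θ := hθ.le
  have h14 : 1 - 4 * θ > 0 := by linarith
  -- the fixed moment order
  set k : ℕ := ⌈(2 * q + 1) / (1 - 4 * θ)⌉₊ + 1 with hk
  have hk1 : 1 ≤ k := by rw [hk]; omega
  have hkq : (4 * k : ℕ) * θ < (k : ℝ) - 2 * q := by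
    have h1 : (2 * q + 1) / (1 - 4 * θ) ≤ (⌈(2 * q + 1) / (1 - 4 * θ)⌉₊ : ℝ) := Nat.le_ceil _
    have h2 : (k : ℝ) = (⌈(2 * q + 1) / (1 - 4 * θ)⌉₊ : ℝ) + 1 := by rw [hk]; push_cast; ring
    have h3 : (2 * q + 1) ≤ (⌈(2 * q + 1) / (1 - 4 * θ)⌉₊ : ℝ) * (1 - 4 * θ) := by rwa [div_le_iff₀ h14] at h1
    push_cast
    nlinarith
  set Cp : ℝ := max C 1 with hCp
  have hCp1 : 1 ≤ Cp := le_max_right _ _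
  have hCpos : 0 < Cp := by linarith
  have hCCp : C ≤ Cp := le_max_left _ _
  set Kst : ℝ := (2 * k - 1 : ℝ) ^ (k * 3) * 8 ^ k * C₅ ^ k with hKst
  have hKst0 : 0 ≤ Kst := by
    have : (1 : ℝ) ≤ 2 * k - 1 := by
      have : (1 : ℝ) ≤ k := by exact_mod_cast hk1
      linarith
    rw [hKst]; positivity
  -- thresholds
  obtain ⟨b₀, hb₀1, hb₀⟩ := ErrorBudget.exists_forall_natPow_log_le (k := 2) (γ := 1 / 2 - κ₃) hθ0 (by push_cast; linarith) hc₀ 1 0 0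
  obtain ⟨b₁, hb₁1, hb₁⟩ := ErrorBudget.exists_forall_natPow_log_le (k := 4) (γ := 1 / 2 - κ₃) hθ0 (by push_cast; linarith) hc₀ 1 0 0
  obtain ⟨b₂, hb₂1, hb₂⟩ := ErrorBudget.exists_forall_natPow_log_le (k := 0) (γ := 2 * κ₃) hθ0 (by push_cast; linarith) one_pos C 1 0
  obtain ⟨b₃, hb₃1, hb₃⟩ := ErrorBudget.exists_forall_natPow_log_le (k := 4 * k) (γ := (k : ℝ) - 2 * q) hθ0 hkq one_pos (Cp ^ 2 * Kst) (3 * k) 0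
  obtain ⟨b₄, hb₄1, hb₄⟩ := ErrorBudget.exists_forall_natPow_log_le (k := 4 * k) (γ := (k : ℝ)) hθ0 (by push_cast; nlinarith) hc₁ Kst (3 * k) 0
  refine ⟨C₅, max (max b₀ b₁) (max b₂ (max b₃ b₄)), hC₅, le_max_of_le_left (le_max_of_le_left hb₀1), ?_⟩
  intro β hβ H hH hHβ r hsr
  have hβ0 : b₀ ≤ β := ((le_max_left _ _).trans (le_max_left _ _)).trans hβ
  have hβ1 : b₁ ≤ β := ((le_max_right _ _).trans (le_max_left _ _)).trans hβ
  have hβ2 : b₂ ≤ β := ((le_max_left _ _).trans (le_max_right _ _)).trans hβ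
  have hβ3 : b₃ ≤ β := (((le_max_left _ _).trans (le_max_right _ _)).trans (le_max_right _ _)).trans hβ
  have hβ4 : b₄ ≤ β := (((le_max_right _ _).trans (le_max_right _ _)).trans (le_max_right _ _)).trans hβ
  have hβone : 1 ≤ β := hb₀1.trans hβ0
  have hβpos : 0 < β := by linarith
  set s : ℝ := β ^ (-1 / 2 + κ₃) with hs
  have hspos : 0 < s := Real.rpow_pos_of_pos hβpos _
  -- premises
  have hsH : s * (H : ℝ) ^ 2 ≤ c₀ := by
    have e : s * (H : ℝ) ^ 2 = 1 * (H : ℝ) ^ 2 * (1 + Real.log H) ^ 0 * (1 + Real.log β) ^ 0 / β ^ (1 / 2 - κ₃) := by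
      rw [hs, rpow_eq_one_div hβpos, pow_zero, pow_zero]; ring
    rw [e]; exact hb₀ β hβ0 H hH hHβ
  have hsH4 : s * (H : ℝ) ^ 4 ≤ c₀ := by
    have e : s * (H : ℝ) ^ 4 = 1 * (H : ℝ) ^ 4 * (1 + Real.log H) ^ 0 * (1 + Real.log β) ^ 0 / β ^ (1 / 2 - κ₃) := by
      rw [hs, rpow_eq_one_div hβpos, pow_zero, pow_zero]; ring
    rw [e]; exact hb₁ β hβ1 H hH hHβ
  have hCβ : C * (1 + Real.log H) ≤ β * s ^ 2 := by
    have h := hb₂ β hβ2 H hH hHβ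
    rw [pow_zero, pow_one, pow_zero, mul_one, mul_one, div_le_one (Real.rpow_pos_of_pos hβpos _)] at h
    rw [hs, beta_mul_rpow_sq hβpos]
    exact h
  -- the tail at the fixed `k`
  have hmono := tail_monomial_eq k C₅ β (H : ℝ) (1 + Real.log H)
  have hβk : β ^ k = β ^ ((k : ℝ) - 2 * q) * β ^ (2 * q) := pow_eq_rpow_mul_rpow hβpos k
  have hpk_le : (2 * k - 1 : ℝ) ^ (k * 3) * (8 * (C₅ * (H : ℝ) ^ 4 * (1 + Real.log H) ^ 3) / β) ^ k / (1 : ℝ) ^ (2 * k) ≤ c₁ := by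
    rw [hmono]
    have h := hb₄ β hβ4 H hH hHβ
    rw [pow_zero, mul_one, Real.rpow_natCast] at h
    exact h
  have hpk_sq : Cp ^ 2 * ((2 * k - 1 : ℝ) ^ (k * 3) * (8 * (C₅ * (H : ℝ) ^ 4 * (1 + Real.log H) ^ 3) / β) ^ k / (1 : ℝ) ^ (2 * k)) ≤
      β ^ (-(2 * q)) := by
    rw [hmono]
    have h := hb₃ β hβ3 H hH hHβ
    rw [pow_zero, mul_one] at h
    have hβ2q : 0 < β ^ (2 * q) := Real.rpow_pos_of_pos hβpos _
    have hβkq : 0 < β ^ ((k : ℝ) - 2 * q) := Real.rpow_pos_of_pos hβpos _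
    calc Cp ^ 2 * (Kst * (H : ℝ) ^ (4 * k) * (1 + Real.log H) ^ (3 * k) / β ^ k)
        = (Cp ^ 2 * Kst * (H : ℝ) ^ (4 * k) * (1 + Real.log H) ^ (3 * k) / β ^ ((k : ℝ) - 2 * q)) / β ^ (2 * q) := by
          rw [hβk]; field_simp
      _ ≤ 1 / β ^ (2 * q) := div_le_div_of_nonneg_right h hβ2q.le
      _ = β ^ (-(2 * q)) := by rw [Real.rpow_neg hβpos.le, one_div]
  -- `C √p_k ≤ β^{−q}`
  set p : ℝ := (2 * k - 1 : ℝ) ^ (k * 3) * (8 * (C₅ * (H : ℝ) ^ 4 * (1 + Real.log H) ^ 3) / β) ^ k / (1 : ℝ) ^ (2 * k) with hpdef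
  have hL : 0 ≤ 1 + Real.log H := by
    have := Real.log_nonneg (show (1 : ℝ) ≤ (H : ℝ) by exact_mod_cast hH)
    linarith
  have hp0 : 0 ≤ p := by
    rw [hmono]
    exact div_nonneg (mul_nonneg (mul_nonneg hKst0 (pow_nonneg (Nat.cast_nonneg _) _)) (pow_nonneg hL _)) (pow_nonneg hβpos.le _)
  have hsqrt : Cp * Real.sqrt p ≤ β ^ (-q) := by
    have h1 : Real.sqrt (Cp ^ 2 * p) ≤ Real.sqrt (β ^ (-(2 * q))) := Real.sqrt_le_sqrt hpk_sq
    rw [Real.sqrt_mul (sq_nonneg _), Real.sqrt_sq hCpos.le] at h1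
    have h2 : Real.sqrt (β ^ (-(2 * q))) = β ^ (-q) := by
      rw [show (-(2 * q) : ℝ) = -q * 2 by ring, Real.rpow_mul hβpos.le, Real.rpow_two, Real.sqrt_sq (Real.rpow_nonneg hβpos.le _)]
    rwa [h2] at h1
  -- apply the sharp cut
  have hmain := hcut H hH β r s hβpos hspos hsr hsH hCβ hsH4 1 one_pos k hk1 hpk_le
  have hIden : 0 ≤ ∫ a in smallField H (s / 2) \ {a | 1 + C₅ * β * (H : ℝ) ^ 4 * s ^ 5 ≤ |cubicVertex β H a|}, fpChartWeight β H r a :=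
    setIntegral_nonneg ((ChartGauss.measurableSet_smallField _).diff (measurableSet_cubicCut β C₅ s 1))
      fun a _ => FPChart.fpChartWeight_nonneg β r a
  refine hmain.trans (mul_le_mul_of_nonneg_right ?_ hIden)
  calc C * Real.sqrt p ≤ Cp * Real.sqrt p := mul_le_mul_of_nonneg_right hCCp (Real.sqrt_nonneg _)
    _ ≤ β ^ (-q) := hsqrt

end SmallFieldFPSharp

end Summit.QuantumFields.YangMills.Theorems.AllWindowsColdBoxBoxHighLine
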